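import Literature.Probability.LatticeModels.LupuCouplingDensityBound
import HarnessLib

/-!
# Proof of `Lupu2016_cableSignClustersBounded` (Lupu 2016, Prop. 5.5)

Topic `Literature/Probability/LatticeModels`; proofs-only companion of `CableGFFLevelSets.lean`,
discharging the named fact `Literature.Probability.LatticeModels.Lupu2016_cableSignClustersBounded`:
for `d ≥ 3` and every version `g` of the discrete Gaussian free field of `ℤ^d`, for every site `x`,
almost surely the inhomogeneous Bernoulli bond configuration with the Lupu weights
`lupuWeight g(ω)` (the vertex trace of the positive excursion set of the cable-system free field)
has no infinite cluster at `x` — Lupu, *Ann. Probab.* 44 (2016), Prop. 5.5: "With probability one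
`𝒞'` has only finite clusters".

## The proof (files `DirichletGreen*`, `DiscreteGFF*`, `LupuCoupling*` of this directory)

Lupu's proof: Lemma 5.3 (uniqueness of the infinite cluster, Gandolfi–Keane–Newman: translation
invariance + positive finite energy), Lemma 5.4 (Harris–FKG for `ω`, from the FKG inequality for
the loop soup), Prop. 5.2 (`P(x ↔ y) = (2/π) arcsin(G(x,y)/G(0,0))`, from the coin structure of
Thm. 1 bis), and then `θ(x)² ≤ P(x ↔ x_n) → 0`. The coin structure of INFINITE clusters, which
Lupu obtains from the loop-soup limit of §4 (Prop. 4.2) and which underlies both the finite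
energy of Lemma 5.3 and Prop. 5.2, is replaced here by finite-volume statements and soft
arguments, keeping the architecture "cluster-count bound + correlation bound + two-point decay":

1. the finite-volume coin structure (Lupu §4, exact: flipping the sign of the Dirichlet field
   `ψ^Λ` on a finite cluster preserves the joint law; one-site Gaussian innovations, no densities)
   gives `E[ψ_x ψ_y ; x ↔ y in Λ] = G_Λ(x,y)` (`LupuCouplingFiniteVolume`), and Lupu's own
   finite-volume approximation `ψ^{Λ_n} → φ` (proof of Prop. 4.2) transported as an inequality
   gives the **two-point bound** `E[|φ_x φ_y| ; x ↔ y] ≤ G(x - y)`, whence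
   `μ̄(x ↔ y) ≤ 2ν{|φ_0| < δ} + δ⁻² G(x - y) → 0` (`LupuCouplingTwoPointDecay`) in place of Prop. 5.2;
2. the Burton–Keane trifurcation count with cut-balls made of three infinite clusters OF THE
   SAME SIGN (a Cameron–Martin shift of the field opens a box; translation invariance of the
   free-field law) gives `μ̄(N = ∞) = 0` (`LupuCouplingNoInfinitelyMany`) in place of Lemma 5.3;
3. a Cauchy–Schwarz count in a box (`LupuCouplingDensityBound`) in place of Lemma 5.4:
   `θ ≤ √(k(2ν{|φ_0|<δ} + δ⁻²|Λ_n|⁻²∑_{x,y∈Λ_n} G(x-y))) + μ̄(N ≥ k+1)`; letting `n → ∞`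
   (`tendsto_latticeGreen_blockAverage`), `δ → 0` (the one-site law has no atom) and `k → ∞`
   yields `θ = μ̄(0 ↔ ∞) = 0` (`annealedLaw_percolatesAt_zero` below), hence the quenched
   probabilities vanish a.s. for the symmetric weights and a fortiori for `lupuWeight ≤ symWeight`
   (`prodBernoulli_mono_of_isUpperSet`), and the statement transfers from the canonical space to
   any version `(Ω, P, g)` (`IsDiscreteGFF.map_field`, `ae_of_ae_map`).

References: T. Lupu, *From loop clusters and random interlacements to the free field*, Ann.
Probab. 44 (2016) 2117–2146, §4–5, Prop. 5.5 [`Lupu2016`].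
-/

noncomputable section

namespace Literature.Probability.LatticeModels

open _root_.MeasureTheory _root_.ProbabilityTheory Finset Filter _root_.Topology
  Literature.Probability.Percolation SimpleGraph
open scoped ENNReal NNReal

variable {d : ℕ}

namespace IsDiscreteGFF

variable {ν : Measure (Site d → ℝ)}

/-- **The small-ball probabilities vanish**: `ν{|φ_0| < 1/(j+1)} → ν{φ_0 = 0} = 0` (`d ≥ 3`).
[folklore] -/
theorem tendsto_measureReal_abs_coord_lt (hν : IsDiscreteGFF ν (coordProc d)) (hd : 3 ≤ d) :
    Tendsto (fun j : ℕ => ν.real {φ : Site d → ℝ | |φ (0 : Site d)| < 1 / ((j : ℝ) + 1)}) atTop (𝓝 0) := by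
  have hP := hν.1.isProbabilityMeasure
  set S : ℕ → Set (Site d → ℝ) := fun j => {φ | |φ (0 : Site d)| < 1 / ((j : ℝ) + 1)} with hS
  have hSm : ∀ j, MeasurableSet (S j) := fun j =>
    measurableSet_lt (measurable_pi_apply 0).abs measurable_const
  have hanti : Antitone S := by
    intro j j' hjj' φ hφ
    have h1 : (1 : ℝ) / ((j' : ℝ) + 1) ≤ 1 / ((j : ℝ) + 1) :=
      one_div_le_one_div_of_le (by positivity) (by exact_mod_cast Nat.succ_le_succ hjj')
    exact lt_of_lt_of_le hφ h1
  have hinter : ⋂ j, S j = {φ : Site d → ℝ | φ (0 : Site d) = 0} := by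
    ext φ
    simp only [Set.mem_iInter, hS, Set.mem_setOf_eq]
    constructor
    · intro h
      by_contra hne
      obtain ⟨j, hj⟩ := exists_nat_one_div_lt (abs_pos.2 hne)
      exact lt_irrefl _ ((h j).trans hj)
    · intro h j
      rw [h, abs_zero]
      positivity
  have hlim := tendsto_measure_iInter_atTop (μ := ν) (fun j => (hSm j).nullMeasurableSet) hanti
    ⟨0, measure_ne_top _ _⟩
  rw [hinter, hν.measure_coord_eq_zero hd 0] at hlim
  have := (ENNReal.tendsto_toReal ENNReal.zero_ne_top).comp hlim
  rw [ENNReal.toReal_zero] at this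
  exact this

/-- **`μ̄(N ≥ k+1) → μ̄(N = ∞) = 0`** as `k → ∞` (`d ≥ 3`). [cite: Lupu2016, Lemma 5.3] -/
theorem tendsto_annealedLaw_real_atLeastInfClusters (hν : IsDiscreteGFF ν (coordProc d)) (hd : 3 ≤ d) :
    Tendsto (fun k : ℕ => (annealedLaw ν).real (atLeastInfClusters (Site d) (k + 1))) atTop (𝓝 0) := by
  have hP := hν.1.isProbabilityMeasure
  set S : ℕ → Set (BondConfig (Site d)) := fun k => atLeastInfClusters (Site d) (k + 1) with hS
  have hanti : Antitone S := by
    intro k k' hkk' ω hω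
    rw [hS, mem_atLeastInfClusters_iff] at hω ⊢
    exact le_trans (by exact_mod_cast Nat.succ_le_succ hkk') hω
  have hinter : annealedLaw ν (⋂ k, S k) = 0 := by
    refine measure_mono_null (fun ω hω => ?_) (hν.annealedLaw_numInfiniteClusters_eq_top hd)
    rw [Set.mem_iInter] at hω
    change numInfiniteClusters ω = ⊤
    rw [ENat.eq_top_iff_forall_ge]
    intro m
    have := (mem_atLeastInfClusters_iff ω (m + 1)).1 (hω m)
    exact le_trans (by exact_mod_cast Nat.le_succ m) this
  have hlim := tendsto_measure_iInter_atTop (μ := annealedLaw ν)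
    (fun k => (measurableSet_atLeastInfClusters (k + 1)).nullMeasurableSet) hanti ⟨0, measure_ne_top _ _⟩
  rw [hinter] at hlim
  have := (ENNReal.tendsto_toReal ENNReal.zero_ne_top).comp hlim
  rw [ENNReal.toReal_zero] at this
  exact this

/-- **`θ = μ̄(0 ↔ ∞) = 0`** for Lupu's annealed bond law on `ℤ^d`, `d ≥ 3` — the content of
Lupu 2016, Prop. 5.5 for the symmetric (two-sided) model: from the density bound
`annealedLaw_real_percolatesAt_le`, letting the box grow (`tendsto_latticeGreen_blockAverage`),
then `δ → 0` (`tendsto_measureReal_abs_coord_lt`), then `k → ∞`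
(`tendsto_annealedLaw_real_atLeastInfClusters`). [cite: Lupu2016, Prop. 5.5] -/
theorem annealedLaw_percolatesAt_zero (hν : IsDiscreteGFF ν (coordProc d)) (hd : 3 ≤ d) :
    annealedLaw ν (percolatesAt (0 : Site d)) = 0 := by
  have hP := hν.1.isProbabilityMeasure
  set θ := (annealedLaw ν).real (percolatesAt (0 : Site d)) with hθ
  set sδ : ℝ → ℝ := fun δ => ν.real {φ : Site d → ℝ | |φ (0 : Site d)| < δ} with hsδ
  set b : ℕ → ℝ := fun n => (∑ x ∈ box d n, ∑ y ∈ box d n, latticeGreen (x - y) / 2) /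
    ((box d n).card : ℝ) ^ 2 with hb
  set p : ℕ → ℝ := fun k => (annealedLaw ν).real (atLeastInfClusters (Site d) (k + 1)) with hp
  -- Step A: the density bound
  have hA : ∀ (k n : ℕ) {δ : ℝ}, 0 < δ → θ ≤ Real.sqrt (k * (2 * sδ δ + (δ ^ 2)⁻¹ * b n)) + p k :=
    fun k n δ hδ => hν.annealedLaw_real_percolatesAt_le hd n k hδ
  -- Step B: `n → ∞`
  have hblim : Tendsto b atTop (𝓝 0) := by
    have h := (tendsto_latticeGreen_blockAverage d hd).const_mul (1 / 2 : ℝ)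
    rw [mul_zero] at h
    refine h.congr fun n => ?_
    simp only [hb, ← Finset.sum_div]
    ring
  have hB : ∀ (k : ℕ) {δ : ℝ}, 0 < δ → θ ≤ Real.sqrt (k * (2 * sδ δ)) + p k := by
    intro k δ hδ
    have hlim : Tendsto (fun n => Real.sqrt (k * (2 * sδ δ + (δ ^ 2)⁻¹ * b n)) + p k) atTop
        (𝓝 (Real.sqrt (k * (2 * sδ δ)) + p k)) := by
      have : Tendsto (fun n => (k : ℝ) * (2 * sδ δ + (δ ^ 2)⁻¹ * b n)) atTop (𝓝 (k * (2 * sδ δ))) := by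
        have h := (hblim.const_mul (δ ^ 2)⁻¹).const_add (2 * sδ δ) |>.const_mul (k : ℝ)
        simpa using h
      exact (this.sqrt).add_const _
    exact ge_of_tendsto' hlim fun n => hA k n hδ
  -- Step C: `δ → 0`
  have hC : ∀ k : ℕ, θ ≤ p k := by
    intro k
    have hlim : Tendsto (fun j : ℕ => Real.sqrt (k * (2 * sδ (1 / ((j : ℝ) + 1)))) + p k) atTop
        (𝓝 (Real.sqrt (k * (2 * 0)) + p k)) :=
      ((((hν.tendsto_measureReal_abs_coord_lt hd).const_mul 2).const_mul (k : ℝ)).sqrt).add_const _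
    rw [mul_zero, mul_zero, Real.sqrt_zero, zero_add] at hlim
    exact ge_of_tendsto' hlim fun j => hB k (by positivity)
  -- Step D: `k → ∞`
  have hD : θ ≤ 0 := ge_of_tendsto' (hν.tendsto_annealedLaw_real_atLeastInfClusters hd) hC
  have hθ0 : θ = 0 := le_antisymm hD measureReal_nonneg
  exact (measureReal_eq_zero_iff (measure_ne_top _ _)).1 hθ0

/-- `φ ↦ P_φ(B)` is measurable for every event `B` (a section of the joint measure). [folklore] -/
theorem measurable_prodBernoulli_symWeight {B : Set (BondConfig (Site d))} (hB : MeasurableSet B) :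
    Measurable fun φ : Site d → ℝ => prodBernoulli (symWeight φ) B := by
  have := isProbabilityMeasure_labelMeasure (Site d)
  have hfun : (fun φ : Site d → ℝ => prodBernoulli (symWeight φ) B) = fun φ =>
      labelMeasure (Site d) (Prod.mk φ ⁻¹' {p : (Site d → ℝ) × Labels d | symConfig p.1 p.2 ∈ B}) := by
    funext φ
    exact (labelMeasure_symConfig_preimage φ hB).symm
  rw [hfun]
  exact measurable_measure_prodMk_left (measurable_symConfig hB)

/-- **The quenched percolation probabilities vanish a.s.** (`d ≥ 3`): for `ν`-a.e. field `φ`,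
`prodBernoulli (lupuWeight φ) {|C(x)| = ∞} = 0` — `θ(x) = θ(0) = 0` for the symmetric weights,
and `lupuWeight ≤ symWeight` with `{|C(x)| = ∞}` increasing. [cite: Lupu2016, Prop. 5.5] -/
theorem ae_prodBernoulli_lupuWeight_percolatesAt (hν : IsDiscreteGFF ν (coordProc d)) (hd : 3 ≤ d)
    (x : Site d) : ∀ᵐ φ ∂ν, prodBernoulli (lupuWeight φ) (percolatesAt x) = 0 := by
  have hP := hν.1.isProbabilityMeasure
  have h0 : annealedLaw ν (percolatesAt x) = 0 := by
    rw [hν.annealedLaw_percolatesAt_eq x, hν.annealedLaw_percolatesAt_zero hd]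
  rw [annealedLaw_apply ν (measurableSet_percolatesAt_holds x),
    lintegral_eq_zero_iff (measurable_prodBernoulli_symWeight (measurableSet_percolatesAt_holds x))] at h0
  filter_upwards [h0] with φ hφ
  have hle := prodBernoulli_mono_of_isUpperSet (lupuWeight_le_symWeight φ)
    (isUpperSet_percolatesAt x) (measurableSet_percolatesAt_holds x)
  rw [show prodBernoulli (symWeight φ) (percolatesAt x) = 0 from hφ] at hle
  exact le_antisymm hle bot_le

end IsDiscreteGFF

/-- **Discharge of `Lupu2016_cableSignClustersBounded` (Lupu 2016, Prop. 5.5, vertex trace).**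
For `d ≥ 3`, every version `(Ω, P, g)` of the discrete Gaussian free field of `ℤ^d` and every
site `x`: for `P`-a.e. `ω`, the inhomogeneous Bernoulli bond percolation with the Lupu weights of
`g(ω)` has `|C(x)| < ∞` almost surely. Push `P` forward to the canonical space
(`IsDiscreteGFF.map_field`), apply `IsDiscreteGFF.ae_prodBernoulli_lupuWeight_percolatesAt`, and
pull the almost-sure statement back (`ae_of_ae_map`). [cite: Lupu2016, Prop. 5.5] -/
theorem Lupu2016_cableSignClustersBounded_holds : Lupu2016_cableSignClustersBounded := by
  intro d hd Ω _ P _ g hg x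
  have hν := hg.map_field
  have hae := hν.ae_prodBernoulli_lupuWeight_percolatesAt hd x
  have hG : AEMeasurable (fun (ω : Ω) (y : Site d) => g y ω) P :=
    aemeasurable_pi_lambda _ fun y => hg.1.aemeasurable y
  exact ae_of_ae_map hG hae

end Literature.Probability.LatticeModels
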